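import Summits.ValiantsHypothesis.ValiantsHypothesis.Theorems.BarrierLeverChowHitsPartitionMinorsRNoStar
import Summits.ValiantsHypothesis.ValiantsHypothesis.Theorems.BarrierLeverChowHitsPartitionMinorsRXStar

/-!
# Route BarrierLever — item `ChowHitsPartitionMinorsR` (stmt-ValiantsHypothesis-21882):
# the UNCONDITIONAL glue «narrowed NoStar nodes ⟹ registered v1 nodes ⟹ the item» (RULING R47)

Helper file (`--supports stmt-ValiantsHypothesis-21882`; cell valiant-natproofs, rung V4, 𝒟-side support item of route
BarrierLever; prover seat val-np-p5 gen 30). Definition-free. Closes NO item. Companion of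
`…ChowHitsPartitionMinorsRNoStar` (node texts, predicate `ChowNoStar.IsXStarCertifiable`, padding arrow
`ChowNoStar.chowHits_mono`):

* `chowHits_of_isXStarCertifiable` — an x-star-certifiable layout is hit by `M` affine forms for every `M ≥ h`
  (x-star arrow `ChowXStar.chowHits_of_xstarMatrix`, p714438, + padding);
* `chowHits_of_isXStarCertifiable_swap` — if the swapped layout `(w, u)` is x-star-certifiable («y-star»), `(u, w)`
  is hit by `M ≥ h` forms (`ChowFacePrivate.chow_hit_swap_fin`);
* `stub_thickPairsChowR_of_noStar`, `stub_thickLowerSetsChowR_of_noStar` — the narrowed nodes imply the registered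
  v1 nodes (threshold `max h₀ 3` for the lower-set node: `h + 2h ≤ h·h` needs `h ≥ 3`);
* `chowHitsPartitionMinorsR_of_thickPairsNoStar`, `chowHitsPartitionMinorsR_of_thickLowerSetsNoStar` — EACH narrowed
  node alone implies `Theses.BarrierLever.ChowHitsPartitionMinorsR`.

WHAT THIS IS NOT: item 21882 is NOT proved; nothing on crux stmt-ValiantsHypothesis-14610 or on `VP` versus `VNP`.
-/

set_option linter.dupNamespace false

namespace Summit.ValiantsHypothesis.ValiantsHypothesis.Theorems.BarrierLever.ChowNoStar

open Finset MvPolynomial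
open Summit.ValiantsHypothesis.ValiantsHypothesis.Theorems.BarrierLever.ChowFacePrivate (chow_hit_swap_fin)
open Summit.ValiantsHypothesis.ValiantsHypothesis.Theorems.BarrierLever.ChowXStar (chowHits_of_xstarMatrix)

noncomputable section

variable {h r : ℕ}

/-! ## 1. x-star / y-star certified layouts at every budget `M ≥ h` -/

/-- **x-star-certifiable layouts are hit by `M` affine forms for every `M ≥ h`** (p714438 + padding). -/
theorem chowHits_of_isXStarCertifiable {M : ℕ} (hM : h ≤ M) (u w : Fin r → Finset (Fin h))
    (hX : IsXStarCertifiable u w) :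
    ∃ ℓ : Fin M → MvPolynomial (Fin (h + h)) ℂ, (∀ k, (ℓ k).totalDegree ≤ 1) ∧
      (Matrix.of fun i j : Fin r => MvPolynomial.coeff (∑ a ∈ u i, Finsupp.single (Fin.castAdd h a) 1 +
          ∑ c ∈ w j, Finsupp.single (Fin.natAdd h c) 1) (∏ k, ℓ k)).det ≠ 0 := by
  obtain ⟨β, hβ⟩ := hX
  exact chowHits_mono hM u w (chowHits_of_xstarMatrix u w β hβ)

/-- **y-star: if the SWAPPED layout `(w, u)` is x-star-certifiable, `(u, w)` is hit by `M` affine forms for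
every `M ≥ h`** (x-star arrow for `(w, u)` + the `x ↔ y` flip `ChowFacePrivate.chow_hit_swap_fin` + padding). -/
theorem chowHits_of_isXStarCertifiable_swap {M : ℕ} (hM : h ≤ M) (u w : Fin r → Finset (Fin h))
    (hY : IsXStarCertifiable w u) :
    ∃ ℓ : Fin M → MvPolynomial (Fin (h + h)) ℂ, (∀ k, (ℓ k).totalDegree ≤ 1) ∧
      (Matrix.of fun i j : Fin r => MvPolynomial.coeff (∑ a ∈ u i, Finsupp.single (Fin.castAdd h a) 1 +
          ∑ c ∈ w j, Finsupp.single (Fin.natAdd h c) 1) (∏ k, ℓ k)).det ≠ 0 :=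
  chow_hit_swap_fin u w (chowHits_of_isXStarCertifiable hM w u hY)

/-! ## 2. Kernel glue (unconditional): narrowed nodes ⟹ v1 nodes -/

/-- **GLUE (R47, thick pairs): the narrowed node implies the registered node v1a** — x-star- or y-star-certifiable
layouts are hit by `h ≤ h·h` forms (`chowHits_of_isXStarCertifiable[_swap]`), the rest by the narrowed node
(same `h₀`). -/
theorem stub_thickPairsChowR_of_noStar (hN : Stmt.stub_thickPairsChowRNoStar) : Stmt.stub_thickPairsChowR := by
  obtain ⟨h₀, hN⟩ := hN
  refine ⟨h₀, fun h hh r u w hu hw hU hW => ?_⟩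
  have hM : h ≤ h * h := Nat.le_mul_self h
  by_cases hX : IsXStarCertifiable u w
  · exact chowHits_of_isXStarCertifiable hM u w hX
  by_cases hY : IsXStarCertifiable w u
  · exact chowHits_of_isXStarCertifiable_swap hM u w hY
  exact hN h hh r u w hu hw hU hW hX hY

/-- **GLUE (R47, thick lower-set pairs): the narrowed node implies the registered node v1b** — x-star- or
y-star-certifiable pairs are hit by `m = h` forms and `h + 2h ≤ h·h` for `h ≥ 3` (threshold `max h₀ 3`), the rest
by the narrowed node. -/
theorem stub_thickLowerSetsChowR_of_noStar (hN : Stmt.stub_thickLowerSetsChowRNoStar) :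
    Stmt.stub_thickLowerSetsChowR := by
  obtain ⟨h₀, hN⟩ := hN
  refine ⟨max h₀ 3, fun h hh r v w' hv hw hlv hlw hV hW => ?_⟩
  have hh₀ : h₀ ≤ h := le_trans (le_max_left _ _) hh
  have h3 : 3 ≤ h := le_trans (le_max_right _ _) hh
  have hbudget : h + 2 * h ≤ h * h := by nlinarith
  by_cases hX : IsXStarCertifiable v w'
  · exact ⟨h, hbudget, chowHits_of_isXStarCertifiable le_rfl v w' hX⟩
  by_cases hY : IsXStarCertifiable w' v
  · exact ⟨h, hbudget, chowHits_of_isXStarCertifiable_swap le_rfl v w' hY⟩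
  exact hN h hh₀ r v w' hv hw hlv hlw hV hW hX hY

/-! ## 3. Compositions into the item, BY NAME -/

/-- **COMPOSITION (R47, kernel): the narrowed thick-pairs node ALONE closes item 21882.** -/
theorem chowHitsPartitionMinorsR_of_thickPairsNoStar (hN : Stmt.stub_thickPairsChowRNoStar) :
    Summit.ValiantsHypothesis.ValiantsHypothesis.Theses.BarrierLever.ChowHitsPartitionMinorsR :=
  chowHitsPartitionMinorsR_of_thickPairs (stub_thickPairsChowR_of_noStar hN)

/-- **COMPOSITION (R47, kernel): the narrowed thick lower-set node ALONE closes item 21882.** -/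
theorem chowHitsPartitionMinorsR_of_thickLowerSetsNoStar (hN : Stmt.stub_thickLowerSetsChowRNoStar) :
    Summit.ValiantsHypothesis.ValiantsHypothesis.Theses.BarrierLever.ChowHitsPartitionMinorsR :=
  chowHitsPartitionMinorsR_of_thickLowerSets (stub_thickLowerSetsChowR_of_noStar hN)

end

end Summit.ValiantsHypothesis.ValiantsHypothesis.Theorems.BarrierLever.ChowNoStar
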